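import Mathlib.GroupTheory.Perm.Cycle.Basic
import Mathlib.Data.Fintype.EquivFin
import Mathlib.Data.Fin.VecNotation
import Mathlib.Tactic.Ring
import Mathlib.Tactic.LinearCombination
import Mathlib.Algebra.Order.BigOperators.Group.Finset
import Mathlib.Algebra.BigOperators.Fin
import Mathlib.Data.Fintype.Card
import HarnessLib

/-!
# Ring 2 / AbelianAll — pairing independence of Schoen's component torsor (WEIL-2 gen 62, THEOREM Π)

research route, not a corollary; conditional on HC_CM plus one named minimal statement.
`HC_CM` occurs nowhere in this file; nothing here is a case of the Hodge conjecture.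

Fact-free combinatorial / algebraic skeleton of THEOREM Π of the account `PAIRING-G62.md`
(pub-hodge-ring2, seat ab-weil-2, gen 62): for two `H`-stable simple pairings `M, M'` of the
`N`-branch points of a Schoen-simple Hecke datum the component-torsor classes of THEOREM Y (iv)
agree, `[τ^M] = [τ^{M'}]` in `H¹(H; ℤ/f)`.  The geometric proof (Schoen 1988, Lemmas 2.2–2.5:
the cyclic cover `β₀ : W₀ → S^h X` is étale off the branch hyperplanes `S_j` and splits into `f`
sections over each `P₀^M`) has two finite ingredients, proved here in full generality:

* `exists_sign_alternating_two_involutions` — for two fixed-point-free involutions `σ, τ` of a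
  finite set there is a `±1`-valued function `v` with `v ∘ σ = -v` and `v ∘ τ = -v`.  Applied to the
  two pairings viewed as involutions of the `2r` branch points, `v` is a residue vector alternating
  on BOTH pairings with no zero entry, so `P₀^M ∩ P₀^{M'}` contains divisors off every `S_j`
  (and that open part of a projective space is connected).  The key step `pow_mul_apply_ne_sigma`
  says that `x` and `σ x` never lie in the same `⟨τσ⟩`-cycle, i.e. the graph `M ∪ M'` has no odd
  cycle.
* `cocycle_eq_add_coboundary_of_shift` — if the packet labellings of `M` and `M'` over the
  (connected) common locus differ by a constant `s`, the two cocycles differ by the coboundary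
  `h ↦ (u_h - 1) s`.
-/

namespace Summit.HodgeConjecture.Ring2AbelianAll.PairingIndependence

open Equiv

section TwoInvolutions

variable {S : Type*} (σ τ : Perm S)

/-- KEY LEMMA (no odd cycles in the union of two perfect matchings).  For fixed-point-free
involutions `σ, τ` no power of `τ * σ` maps `x` to `σ x`; two-step induction on the exponent using
`(τσ)^(k+2) x = σ x ↔ (τσ)^k (τσ x) = σ (τσ x)`. -/
theorem pow_mul_apply_ne_sigma (hσ : ∀ x, σ x ≠ x) (hτ : ∀ x, τ x ≠ x)
    (hσ2 : ∀ x, σ (σ x) = x) (hτ2 : ∀ x, τ (τ x) = x) :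
    ∀ (k : ℕ) (x : S), ((τ * σ) ^ k) x ≠ σ x := by
  intro k
  induction k using Nat.twoStepInduction with
  | zero =>
      intro x h
      exact hσ x (by simpa using h.symm)
  | one =>
      intro x h
      exact hτ (σ x) (by simpa [Perm.mul_apply] using h)
  | more k ih _ =>
      intro x h
      have e1 : ((τ * σ) ^ (k + 2)) x = τ (σ (((τ * σ) ^ k) (τ (σ x)))) := by
        rw [pow_succ, pow_succ']
        simp [Perm.mul_apply]
      rw [e1] at h
      -- from `τ (σ z) = σ x` deduce `z = σ (τ (σ x))`
      have h2 : ((τ * σ) ^ k) (τ (σ x)) = σ (τ (σ x)) := by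
        have h' := congrArg (fun y => σ (τ y)) h
        simpa [hτ2, hσ2] using h'
      exact ih (τ (σ x)) (by simpa [Perm.mul_apply] using h2)

/-- `x` and `σ x` lie in different cycles of `τ * σ`. -/
theorem not_sameCycle_self_sigma [Finite S] (hσ : ∀ x, σ x ≠ x) (hτ : ∀ x, τ x ≠ x)
    (hσ2 : ∀ x, σ (σ x) = x) (hτ2 : ∀ x, τ (τ x) = x) (x : S) :
    ¬ (τ * σ).SameCycle x (σ x) := by
  intro h
  obtain ⟨i, hi⟩ := h.exists_nat_pow_eq
  exact pow_mul_apply_ne_sigma σ τ hσ hτ hσ2 hτ2 i x hi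

/-- `σ x` and `τ x` lie in the same cycle of `τ * σ` (`(τσ)(σ x) = τ x`). -/
theorem sameCycle_sigma_tau (hσ2 : ∀ x, σ (σ x) = x) (x : S) :
    (τ * σ).SameCycle (σ x) (τ x) :=
  ⟨1, by simp [Perm.mul_apply, hσ2]⟩

/-- `σ (τ x)` and `x` lie in the same cycle of `τ * σ` (`(τσ)(στ x) = x`). -/
theorem sameCycle_sigma_tau_self (hσ2 : ∀ x, σ (σ x) = x) (hτ2 : ∀ x, τ (τ x) = x) (x : S) :
    (τ * σ).SameCycle (σ (τ x)) x :=
  ⟨1, by simp [Perm.mul_apply, hσ2, hτ2]⟩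

/-- A numerical classifier of the cycles of a permutation of a finite type. -/
theorem exists_cycle_classifier [Fintype S] [DecidableEq S] (ρ : Perm S) :
    ∃ c : S → ℕ, (∀ x y, ρ.SameCycle x y → c x = c y) ∧ (∀ x y, c x = c y → ρ.SameCycle x y) := by
  classical
  let e := Fintype.equivFin S
  let cls : S → Finset ℕ := fun x =>
    (Finset.univ.filter fun y => ρ.SameCycle x y).image fun y => (e y : ℕ)
  have mem_cls : ∀ x n, n ∈ cls x ↔ ∃ y, ρ.SameCycle x y ∧ (e y : ℕ) = n := by
    intro x n
    simp [cls]
  have hne : ∀ x, (cls x).Nonempty := fun x => ⟨(e x : ℕ), (mem_cls x _).mpr ⟨x, Perm.SameCycle.rfl, rfl⟩⟩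
  refine ⟨fun x => (cls x).min' (hne x), ?_, ?_⟩
  · intro x y hxy
    apply le_antisymm
    · apply Finset.min'_le
      obtain ⟨z, hz, hz'⟩ := (mem_cls y _).mp (Finset.min'_mem (cls y) (hne y))
      exact (mem_cls x _).mpr ⟨z, hxy.trans hz, hz'⟩
    · apply Finset.min'_le
      obtain ⟨z, hz, hz'⟩ := (mem_cls x _).mp (Finset.min'_mem (cls x) (hne x))
      exact (mem_cls y _).mpr ⟨z, hxy.symm.trans hz, hz'⟩
  · intro x y hxy
    obtain ⟨z, hz, hz'⟩ := (mem_cls x _).mp (Finset.min'_mem (cls x) (hne x))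
    obtain ⟨w, hw, hw'⟩ := (mem_cls y _).mp (Finset.min'_mem (cls y) (hne y))
    have hzw : z = w := by
      apply e.injective
      apply Fin.ext
      rw [hz', hw']
      exact hxy
    exact hz.trans (hzw ▸ hw.symm)

/-- THEOREM Π, combinatorial core (the «two-matchings residue lemma»).  Two fixed-point-free
involutions of a finite set admit a common alternating sign function with no zero:
`v ∘ σ = -v`, `v ∘ τ = -v`, `v x = ±1`.  (`v x := 1` if the `τσ`-cycle of `x` is numbered below
that of `σ x`, else `-1`.) -/
theorem exists_sign_alternating_two_involutions [Fintype S] [DecidableEq S]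
    (hσ : ∀ x, σ x ≠ x) (hτ : ∀ x, τ x ≠ x) (hσ2 : ∀ x, σ (σ x) = x) (hτ2 : ∀ x, τ (τ x) = x) :
    ∃ v : S → ℤ, (∀ x, v x = 1 ∨ v x = -1) ∧ (∀ x, v (σ x) = -v x) ∧ (∀ x, v (τ x) = -v x) := by
  classical
  obtain ⟨c, hc1, hc2⟩ := exists_cycle_classifier (τ * σ)
  have hne : ∀ x, c x ≠ c (σ x) := fun x h =>
    not_sameCycle_self_sigma σ τ hσ hτ hσ2 hτ2 x (hc2 _ _ h)
  refine ⟨fun x => if c x < c (σ x) then 1 else -1, ?_, ?_, ?_⟩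
  · intro x
    by_cases h : c x < c (σ x) <;> simp [h]
  · intro x
    simp only [hσ2]
    by_cases h : c x < c (σ x)
    · have h' : ¬ c (σ x) < c x := by omega
      simp [h, h']
    · have h' : c (σ x) < c x := by have := hne x; omega
      simp [h, h']
  · intro x
    have e1 : c (τ x) = c (σ x) := hc1 _ _ (sameCycle_sigma_tau σ τ hσ2 x).symm
    have e2 : c (σ (τ x)) = c x := hc1 _ _ (sameCycle_sigma_tau_self σ τ hσ2 hτ2 x)
    simp only [e1, e2]
    by_cases h : c x < c (σ x)
    · have h' : ¬ c (σ x) < c x := by omega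
      simp [h, h']
    · have h' : c (σ x) < c x := by have := hne x; omega
      simp [h, h']

/-- The 4-point example of the account (§2): pairings `M = {12, 34}`, `M' = {13, 24}` on
`{0,1,2,3}` and the residue vector `(1,-1,-1,1)`, alternating on both. -/
theorem fourPoint_example :
    let σ : Fin 4 → Fin 4 := ![1, 0, 3, 2]
    let τ : Fin 4 → Fin 4 := ![2, 3, 0, 1]
    let v : Fin 4 → ℤ := ![1, -1, -1, 1]
    (∀ x, v (σ x) = -v x) ∧ (∀ x, v (τ x) = -v x) ∧ ∀ x, v x ≠ 0 := by
  decide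

end TwoInvolutions

section Coboundary

variable {R : Type*} [CommRing R] {G : Type*}

/-- THEOREM Π, cohomological step.  If over the common locus the packet labels of the two
pairings differ by a constant, `t' = t + s`, and `g ∈ H` acts on `M`-labels by
`t ↦ u g * t + τ g` and on `M'`-labels by `t' ↦ u g * t' + τ' g` (the SAME map of components),
then `τ g = τ' g + (u g - 1) * s` for every `g`: the two cocycles differ by the coboundary of `s`,
so their classes in `H¹(H; R)` (here `R = ZMod f`) coincide. -/
theorem cocycle_eq_add_coboundary_of_shift (u τ τ' : G → R) (s : R)
    (h : ∀ (g : G) (t : R), u g * t + τ g + s = u g * (t + s) + τ' g) :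
    ∀ g, τ g = τ' g + (u g - 1) * s := by
  intro g
  have := h g 0
  linear_combination this

/-- Conversely a coboundary shift of the cocycle is realised by relabelling (`t' = t + s`), so
the class — and with it every invariant of THEOREM Y (v) (zero set of the twisted Gauss period up
to translation, the norm class `ν`) — is all that the labelling-free data determine. -/
theorem shift_realises_coboundary (u τ : G → R) (s : R) :
    ∀ (g : G) (t : R),
      u g * t + τ g + s = u g * (t + s) + (τ g - (u g - 1) * s) := by
  intro g t
  ring

/-- The twisted Gauss period transforms under the relabelling `t ↦ t - s` of a coboundary shift by
a root of unity: at exponent level, `a₁ (τ_v - (v-1) s + v t) = a₁ (τ_v + v (t - s)) + a₁ s`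
(so `P_{τ'}(t) = ζ^{a₁ s} P_τ(t - s)` summand by summand, and `|P_{τ'}(t)|² = |P_τ(t-s)|²`). -/
theorem twisted_period_exponent_shift (a₁ τv v s t : R) :
    a₁ * (τv - (v - 1) * s + v * t) = a₁ * (τv + v * (t - s)) + a₁ * s := by
  ring

end Coboundary

section Rigidity

/-- PROPOSITION Ρ (rigidity of the splitting planes), counting core.  `2r` branch points are grouped by a map `cls`
into classes; if every class has at least two members (a singleton class would have `α ≠ 0` as its exponent sum) and
there are at least `r` classes (the residue image has dimension `≥ r`), then every class has EXACTLY two members: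
the grouping is a pairing. -/
theorem classes_are_pairs {S C : Type*} [Fintype S] [Fintype C] [DecidableEq C]
    (cls : S → C) (r : ℕ)
    (hS : Fintype.card S = 2 * r) (hC : r ≤ Fintype.card C)
    (h2 : ∀ c, 2 ≤ (Finset.univ.filter fun s => cls s = c).card) :
    ∀ c, (Finset.univ.filter fun s => cls s = c).card = 2 := by
  classical
  -- card S = Σ_c |fibre c|
  have hsum : (Finset.univ : Finset S).card =
      ∑ c ∈ (Finset.univ : Finset C), (Finset.univ.filter fun s => cls s = c).card := by
    rw [← Finset.card_eq_sum_card_fiberwise (f := cls) (s := Finset.univ) (t := Finset.univ)]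
    intro s _; exact Finset.mem_univ _
  have hge : ∑ c ∈ (Finset.univ : Finset C), (Finset.univ.filter fun s => cls s = c).card
      ≥ ∑ _c ∈ (Finset.univ : Finset C), 2 := Finset.sum_le_sum fun c _ => h2 c
  have hconst : ∑ _c ∈ (Finset.univ : Finset C), (2 : ℕ) = 2 * Fintype.card C := by
    simp [Finset.sum_const, Finset.card_univ, mul_comm]
  have hcardS : (Finset.univ : Finset S).card = 2 * r := by simpa [Finset.card_univ] using hS
  -- hence every inequality is an equality
  by_contra hne
  push Not at hne
  obtain ⟨c₀, hc₀⟩ := hne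
  have h3 : 3 ≤ (Finset.univ.filter fun s => cls s = c₀).card := by
    have := h2 c₀; omega
  have hgt : ∑ c ∈ (Finset.univ : Finset C), (Finset.univ.filter fun s => cls s = c).card
      ≥ (∑ _c ∈ (Finset.univ : Finset C), 2) + 1 := by
    have key : ∑ c ∈ (Finset.univ : Finset C), (Finset.univ.filter fun s => cls s = c).card
        ≥ ∑ c ∈ (Finset.univ : Finset C), (if c = c₀ then 3 else 2) :=
      Finset.sum_le_sum fun c _ => by
        by_cases hc : c = c₀
        · subst hc; simp [h3]
        · simp [hc, h2 c]
    have split : ∑ c ∈ (Finset.univ : Finset C), (if c = c₀ then 3 else 2)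
        = (∑ _c ∈ (Finset.univ : Finset C), 2) + 1 := by
      rw [Finset.sum_ite, Finset.filter_eq', Finset.filter_ne']
      simp [Finset.sum_const, Finset.card_erase_of_mem (Finset.mem_univ c₀), Finset.card_univ]
      have hpos : 1 ≤ Fintype.card C := Fintype.card_pos_iff.mpr ⟨c₀⟩
      omega
    omega
  omega

end Rigidity

end Summit.HodgeConjecture.Ring2AbelianAll.PairingIndependence
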